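import Literature.IUT.HodgeTheaters.ProfiniteCompletionSurfaceBasisCharactersFcov
import Literature.GroupTheory.CombinatorialGroupTheory.SurfaceGroupFiniteIndexSubgroupHolds
import HarnessLib

/-!
# [IUTchI] Lemma 2.7 (v) — UNCONDITIONAL (free and orientable-surface case)

Mochizuki, *Inter-universal Teichmüller theory I*, kurims manuscript (May 2020), §2, Lemma 2.7 (v)
(statement p. 57, proof p. 59) [cite: Mochizuki2012, Lem 2.7(v) p.59] (D-0012 claim key, status disputed
— plain profinite group theory, no side taken).  The named statement
`FreeOrSurface.zHatQuotientNormallyTerminal` (a closed `T̂ ⊆ Ĝ` on which a continuous surjection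
`Ĝ ↠ ℤ̂` is bijective is normally terminal, for `G` free of finite rank OR an orientable surface group)
DISCHARGED WITHOUT HYPOTHESES: `zHatQuotientNormallyTerminal_of_finiteIndexSubgroup`
(`ProfiniteCompletionSurfaceBasisCharactersFcov.lean`, abc-iut-w4-d053 — modulo F_cov only, the degree
hypothesis F_res having been eliminated by `exists_extraspecial_lift_ker`) applied to the theorem
`surfaceGroupFiniteIndexSubgroup_holds` (F_cov = Zieschang–Vogt–Coldewey 4.14.22 / 4.14.23, PROVED by
abc-iut-L5-d3 / abc-iut-L5-t16 via Reidemeister–Schreier).  Theorems only.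
-/

namespace Literature.IUT.HodgeTheaters

namespace FreeOrSurface

universe u

/-- **[IUTchI] Lemma 2.7 (v), unconditional**: for `G` free of finite rank or an orientable surface group,
a closed subgroup `T̂ ⊆ Ĝ` mapped bijectively onto `ℤ̂` by a continuous surjection `Ĝ ↠ ℤ̂` is normally
terminal in `Ĝ`. [cite: Mochizuki2012, Lem 2.7(v) p.59] -/
theorem zHatQuotientNormallyTerminal_holds :
    Literature.IUT.HodgeTheaters.FreeOrSurface.zHatQuotientNormallyTerminal.{u} :=
  zHatQuotientNormallyTerminal_of_finiteIndexSubgroup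
    Literature.GroupTheory.CombinatorialGroupTheory.surfaceGroupFiniteIndexSubgroup_holds

end FreeOrSurface

end Literature.IUT.HodgeTheaters
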